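import Summits.CriticalPhenomena.PercolationContinuityZ3.Theorems.PercNearOneGluingNoHeavyLowerTailCubicThreePointIncTwinClosure
import HarnessLib

/-!
# `NoHeavyLowerTail` (stmt-CriticalPhenomena-4575) — the increasing twin row `T_inc` is preserved by PENDANT gluing and, at measure level, by gluing two
# weighted graphs along the terminal triple

Support file (prover prim-sahi-p2 gen 2, SAHI cell P2; `--supports stmt-CriticalPhenomena-4575`).  No definitions, no named facts, no sorries.
Companion of `…CubicThreePointIncTwinClosure` (law-level closure of `{AG ≥ 0, T_inc ≥ 0}` under join and meet, `tincW_join_nonneg`).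

* `TerminalGluing.tincW_pendant_nonneg` — an arbitrary two-terminal `a–h` network hung at a cut vertex `h` of a system on `(h,b,c)` satisfying `T_inc ≥ 0`
  yields a system on `(a,b,c)` satisfying `T_inc ≥ 0` (the glued law is the MEET with an arm law, `PrW_pendant_*` of `…GluingPendantCells`; `tincH_meet_nonneg`);
* `TerminalGluing.sahiE3_pairLink_nonneg_of_terminalGluing` — MEASURE FORM of `tincW_join_nonneg`: if `w` is supported on `D₁ ∪ D₂` (disjoint edge sets meeting
  only in `a, b, c`) and both restrictions `w·1_{D₁}`, `w·1_{D₂}` satisfy `0 ≤ E₃({a↔b}∪{a↔c}, {a↔b}∪{b↔c}, {a↔c}∪{b↔c})` under `prodBernoulli`, then so does `w`.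
Together with `…IncTwin` (sparse regime, TSP class), `SahiIncRows.tInc_le_five` (≤ 5 vertices) and `…GluingBlobEdge` (blob substitution): the class of weighted
graphs on which the open increasing row holds is closed under terminal gluing, pendant two-terminal networks and blob substitution — a minimal counterexample, if
any, admits none of these decompositions.
[cite: LiebSahi2021, eq. (2.1) (the functional E₃)]; [cite: Gladkov2024StrongFKG, Cor. 4.2 (AG)]
-/

namespace Summit.CriticalPhenomena.PercolationContinuityZ3.Theorems

namespace TerminalGluing

open Finset MeasureTheory Literature.Probability.Percolation Literature.Probability.Percolation.DecisionTree
open Literature.Probability.LatticeModels CubicThreePointTerminal CubicThreePointStep CubicThreePointJoin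

variable {V : Type*} [DecidableEq V]

/-- **Pendant gluing preserves the increasing twin row.**  An arbitrary `a–h` network `(D₁,K₁)` (avoiding `b, c`) glued at the cut vertex `h` to a system
`(D₂,K₂)` on `(h, b, c)` (avoiding `a`): if the law of `(D₂,K₂; h,b,c)` satisfies `T_inc ≥ 0` then so does the law of the glued system on `(a, b, c)`
(its law is the MEET with the arm law of parameter `α = P(a ↔ h)`, `PrW_pendant_*`; `tincH_meet_nonneg`). [cite: Gladkov2024StrongFKG, Cor. 4.2 (AG)] -/
theorem tincW_pendant_nonneg {D₁ D₂ K₁ K₂ : Finset (Sym2 V)} {p : Sym2 V → ℝ} {a b c h : V} (hp0 : ∀ i, 0 ≤ p i) (hp1 : ∀ i, p i ≤ 1)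
    (hD : Disjoint D₁ D₂) (hsep : ∀ v : V, ∀ e₁ ∈ D₁ ∪ K₁, ∀ e₂ ∈ D₂ ∪ K₂, v ∈ e₁ → v ∈ e₂ → v = h)
    (ha : ∀ e ∈ D₂ ∪ K₂, a ∉ e) (hb : ∀ e ∈ D₁ ∪ K₁, b ∉ e) (hc : ∀ e ∈ D₁ ∪ K₁, c ∉ e) (hab : a ≠ b) (hac : a ≠ c)
    (h₂ : 0 ≤ Xi (PrW D₂ p (evQ K₂ h b c)) (PrW D₂ p (evU₁ K₂ h b c)) (PrW D₂ p (evU₂ K₂ h b c)) (PrW D₂ p (evU₃ K₂ h b c)) (PrW D₂ p (evT K₂ h b c))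
      + PrW D₂ p (evQ K₂ h b c) *
        AG (PrW D₂ p (evQ K₂ h b c)) (PrW D₂ p (evU₁ K₂ h b c)) (PrW D₂ p (evU₂ K₂ h b c)) (PrW D₂ p (evU₃ K₂ h b c)) (PrW D₂ p (evT K₂ h b c))) :
    0 ≤ Xi (PrW (D₁ ∪ D₂) p (evQ (K₁ ∪ K₂) a b c)) (PrW (D₁ ∪ D₂) p (evU₁ (K₁ ∪ K₂) a b c)) (PrW (D₁ ∪ D₂) p (evU₂ (K₁ ∪ K₂) a b c))
        (PrW (D₁ ∪ D₂) p (evU₃ (K₁ ∪ K₂) a b c)) (PrW (D₁ ∪ D₂) p (evT (K₁ ∪ K₂) a b c))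
      + PrW (D₁ ∪ D₂) p (evQ (K₁ ∪ K₂) a b c) *
        AG (PrW (D₁ ∪ D₂) p (evQ (K₁ ∪ K₂) a b c)) (PrW (D₁ ∪ D₂) p (evU₁ (K₁ ∪ K₂) a b c)) (PrW (D₁ ∪ D₂) p (evU₂ (K₁ ∪ K₂) a b c))
          (PrW (D₁ ∪ D₂) p (evU₃ (K₁ ∪ K₂) a b c)) (PrW (D₁ ∪ D₂) p (evT (K₁ ∪ K₂) a b c)) := by
  have hα₀ : 0 ≤ PrW D₁ p (evT K₁ a h h) := PrW_nonneg D₁ hp0 hp1 _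
  have hα₁ : PrW D₁ p (evT K₁ a h h) ≤ 1 := by
    rw [← PrW_univ D₁ p]
    exact PrW_mono D₁ hp0 hp1 fun S _ _ => Set.mem_univ S
  have hα₁' : 0 ≤ 1 - PrW D₁ p (evT K₁ a h h) := sub_nonneg.2 hα₁
  have hagy : 0 ≤ AG (0:ℝ) 0 0 (1 - PrW D₁ p (evT K₁ a h h)) (PrW D₁ p (evT K₁ a h h)) := by
    simp only [AG]; nlinarith
  have hty : 0 ≤ Xi (0:ℝ) 0 0 (1 - PrW D₁ p (evT K₁ a h h)) (PrW D₁ p (evT K₁ a h h))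
      + 0 * AG (0:ℝ) 0 0 (1 - PrW D₁ p (evT K₁ a h h)) (PrW D₁ p (evT K₁ a h h)) := by
    simp only [Xi, AG]; nlinarith
  exact IncTwin.tincH_meet_nonneg (PrW_nonneg D₂ hp0 hp1 _) (PrW_nonneg D₂ hp0 hp1 _) (PrW_nonneg D₂ hp0 hp1 _) (PrW_nonneg D₂ hp0 hp1 _)
    (PrW_nonneg D₂ hp0 hp1 _) le_rfl le_rfl le_rfl hα₁' hα₀ (AG_PrW_nonneg h b c hp0 hp1 D₂ K₂) hagy h₂ hty
    (by rw [PrW_pendant_T p hD hsep ha hb hc hab hac]; ring)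
    (by rw [PrW_pendant_U₁ p hD hsep ha hb hc hab hac]; ring)
    (by rw [PrW_pendant_U₂ p hD hsep ha hb hc hab hac]; ring)
    (by rw [PrW_pendant_U₃ p hD hsep ha hb hc hab]; ring)
    (by rw [PrW_pendant_Q p hD hsep ha hb hc hab hac]; ring)

/-- **Measure form: gluing at the terminal triple preserves the increasing row of Sahi's `E₃`.**  If the weight function `w` is supported on
`D₁ ∪ D₂` with `D₁, D₂` disjoint and meeting only in the terminals `a, b, c`, and the restrictions `w·1_{D₁}`, `w·1_{D₂}` both satisfy
`0 ≤ E₃({a↔b}∪{a↔c}, {a↔b}∪{b↔c}, {a↔c}∪{b↔c})`, then so does `w`. [cite: LiebSahi2021, eq. (2.1) (the functional E₃)] -/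
theorem sahiE3_pairLink_nonneg_of_terminalGluing [Fintype V] (w : Sym2 V → unitInterval) {D₁ D₂ : Finset (Sym2 V)} {a b c : V}
    (hD : Disjoint D₁ D₂) (hsep : ∀ v : V, ∀ e₁ ∈ D₁, ∀ e₂ ∈ D₂, v ∈ e₁ → v ∈ e₂ → (v = a ∨ v = b ∨ v = c))
    (hw : ∀ e, e ∉ D₁ ∪ D₂ → w e = 0)
    (h₁ : 0 ≤ sahiE3 (prodBernoulli fun e => if e ∈ D₁ then w e else 0)
      (openConn a b ∪ openConn a c) (openConn a b ∪ openConn b c) (openConn a c ∪ openConn b c))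
    (h₂ : 0 ≤ sahiE3 (prodBernoulli fun e => if e ∈ D₂ then w e else 0)
      (openConn a b ∪ openConn a c) (openConn a b ∪ openConn b c) (openConn a c ∪ openConn b c)) :
    0 ≤ sahiE3 (prodBernoulli w) (openConn a b ∪ openConn a c) (openConn a b ∪ openConn b c) (openConn a c ∪ openConn b c) := by
  have hp0 : ∀ e, 0 ≤ (fun e => ((w e : unitInterval) : ℝ)) e := fun e => unitInterval.nonneg (w e)
  have hp1 : ∀ e, (fun e => ((w e : unitInterval) : ℝ)) e ≤ 1 := fun e => unitInterval.le_one (w e)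
  have hw₁ : ∀ e, e ∉ D₁ → (fun e => if e ∈ D₁ then w e else 0) e = 0 := fun e he => by simp [he]
  have hw₂ : ∀ e, e ∉ D₂ → (fun e => if e ∈ D₂ then w e else 0) e = 0 := fun e he => by simp [he]
  rw [sahiE3_pairLink_eq_Xi_add _ a b c D₁ hw₁] at h₁
  rw [sahiE3_pairLink_eq_Xi_add _ a b c D₂ hw₂] at h₂
  -- `PrW D` only sees the weights on `D` (cf. `CubicFourPointL1.PrW_congr_weights`; inlined to keep the imports light)
  have congr : ∀ (D : Finset (Sym2 V)) (p p' : Sym2 V → ℝ), (∀ e ∈ D, p e = p' e) → ∀ X, PrW D p X = PrW D p' X := by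
    intro D p p' h X
    classical
    unfold PrW
    refine Finset.sum_congr rfl fun S _ => ?_
    have hwt : wtW D p S = wtW D p' S := Finset.prod_congr rfl fun i hi => by rw [h i hi]
    simp only [Set.indicator, hwt]
  have e₁ : ∀ X, PrW D₁ (fun e => (((fun e => if e ∈ D₁ then w e else 0) e : unitInterval) : ℝ)) X =
      PrW D₁ (fun e => ((w e : unitInterval) : ℝ)) X :=
    congr D₁ _ _ (fun e he => by simp [he])
  have e₂ : ∀ X, PrW D₂ (fun e => (((fun e => if e ∈ D₂ then w e else 0) e : unitInterval) : ℝ)) X =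
      PrW D₂ (fun e => ((w e : unitInterval) : ℝ)) X :=
    congr D₂ _ _ (fun e he => by simp [he])
  simp only [e₁] at h₁
  simp only [e₂] at h₂
  rw [sahiE3_pairLink_eq_Xi_add w a b c (D₁ ∪ D₂) hw]
  have hsep' : ∀ v : V, ∀ e₁ ∈ D₁ ∪ ∅, ∀ e₂ ∈ D₂ ∪ ∅, v ∈ e₁ → v ∈ e₂ → (v = a ∨ v = b ∨ v = c) := by
    intro v e₁ he₁ e₂ he₂
    rw [Finset.union_empty] at he₁ he₂
    exact hsep v e₁ he₁ e₂ he₂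
  have key := tincW_join_nonneg (K₁ := ∅) (K₂ := ∅) hp0 hp1 hD hsep' h₁ h₂
  simpa only [Finset.union_empty] using key

end TerminalGluing

end Summit.CriticalPhenomena.PercolationContinuityZ3.Theorems
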